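import Summits.NavierStokesRegularity.NavierStokesRegularity.Theorems.RellichScarSymmetricScarExistsRdssAnyAngleNearOne
import Summits.NavierStokesRegularity.NavierStokesRegularity.Theorems.RellichScarSymmetricScarExistsRotationOrbitContinuity
import Summits.NavierStokesRegularity.NavierStokesRegularity.Theorems.RellichScarSymmetricScarExistsScrewInvariantLimitMoving
import Summits.NavierStokesRegularity.NavierStokesRegularity.Theorems.SymmetricScarExists.Negative.RepairedAssembly

/-!
# Crux `SymmetricScarExists` (stmt-NavierStokesRegularity-11718), line `rdss-screw-split` — fatal BOXES of screws
# around irrational directions (lead c4, wave 4)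

Support file of the line lead (`--supports stmt-NavierStokesRegularity-11718`; registered by-product
`rdssApexFatal_nearIrrationalDirection`).  Upgrades the fatal RAYS of `rdssApexFatal_irrationalAngle_nearOne` (T4)
to fatal BOXES: for every `C`, `I < ⊤` and every angle `θ₀` with `θ₀/2π ∉ ℚ` there are `c⋆ > 1`, `η > 0` such that
child C of the RDSS screw split holds at every screw `(c, θ)` with `1 < c < c⋆`, `|θ − θ₀| < η`, in the class
`𝐈 ≤ I` — by compactness (`Robust.slabLimit_le`), continuity of the dilation AND rotation orbits of the limit in
`L³_loc` (`stub_dilationContinuity`, `stub_rotationOrbitContinuity`), the moving-angle limit lemma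
(`stub_screwInvariantLimitMoving`) and the irrational pure-rotation exclusion (`stub_irrationalRotationApexFatal`).
So near the identity of `ℝ₊ × SO(2)` the possibly non-fatal screws are confined to cusps at the rational directions
(whose rays are fatal for `c^q < c₁`, `Calibration.rdssApexFatal_rationalAngle_nearOne`).  The readback
`rssApexFatal_of_uniformNearIdentity` records why no UNIFORM corner is claimed: a factor bound `Λ(C, I)` valid for all
angles at once would already give the rotated self-similar Liouville theorems `RssApexFatal α` for every pitch
(Pineau–Vicol 2026, Conj. 1.1, open for `α ≈ 1`).

## References

* D. Albritton, T. Barker, ARMA 232 (2019) = arXiv:1811.00502, Lemma 2.2, Prop. 2.3. [AlbrittonBarker2019]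
* B. Pineau, V. Vicol (2026), arXiv:2607.09619, Conj. 1.1, Thm 1.7. [PineauVicol2026]
* G. Seregin, V. Šverák, Comm. PDE 34 (2009), Thm 3.1. [SereginSverak2009]
-/

noncomputable section

open MeasureTheory Set Function Filter Topology TopologicalSpace Metric
open scoped NNReal ENNReal

namespace Summit.NavierStokesRegularity.NavierStokesRegularity.Theorems.SymmetricScarExists.RdssSplit.NearIdentity

set_option linter.dupNamespace false

open Literature.Analysis.FluidPDE
open Summit.NavierStokesRegularity.NavierStokesRegularity.Theses.RellichScar
open Summit.NavierStokesRegularity.NavierStokesRegularity.Theorems.SymmetricScarExists.Negative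

/-- **Optimality of the per-direction statement** (readback): a UNIFORM near-identity corner — one `Λ(C, I) > 1` fatal
for ALL angles at once — already implies the rotated self-similar Liouville theorems `RssApexFatal α` for EVERY pitch
(Pineau–Vicol 2026, Conj. 1.1, open for `α ≈ 1`): an a.e. `α`-RSS profile is a.e. fixed by the screws
`(λ, 2α log λ)` with `λ ↓ 1`.  So `rdssApexFatal_anyAngle_nearOne` / `rdssApexFatal_nearIrrationalDirection` are the
unconditional shadow of that conjecture near the identity. [cite: PineauVicol2026, Conjecture 1.1 (arXiv:2607.09619 p. 3)] -/
theorem rssApexFatal_of_uniformNearIdentity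
    (hU : ∀ (C : ℝ) (I : ℝ≥0∞), I < ⊤ → ∃ Λ : ℝ, 1 < Λ ∧ ∀ c θ : ℝ, 1 < c → c < Λ →
      ∀ (u : ℝ → EuclideanSpace ℝ (Fin 3) → EuclideanSpace ℝ (Fin 3)) (p : ℝ → EuclideanSpace ℝ (Fin 3) → ℝ)
        (G : ℝ → EuclideanSpace ℝ (Fin 3) → EuclideanSpace ℝ (Fin 3) →L[ℝ] EuclideanSpace ℝ (Fin 3)),
        IsSuitableWeakSolutionOn (slab (EuclideanSpace ℝ (Fin 3)) (Iio (0 : ℝ)) isOpen_Iio) 1 0 u p →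
        HasWeakSpatialGradientOn (slab (EuclideanSpace ℝ (Fin 3)) (Iio (0 : ℝ)) isOpen_Iio) u G →
        typeIBound (Iio (0 : ℝ) ×ˢ univ) u p G ≤ I → HasTypeIDecay C u → IsBackwardSingularPoint u 0 →
        uncurry (fun t x => rotZ θ (nsRescale c u t (rotZ (-θ) x)))
          =ᵐ[volume.restrict (Iio (0 : ℝ) ×ˢ (univ : Set (EuclideanSpace ℝ (Fin 3))))] uncurry u → False) :
    ∀ α : ℝ, RssApexFatal α := by
  intro α u p G C hsw hwg hI hdec hsing hrss
  obtain ⟨Λ, hΛ, hfatal⟩ := hU C (typeIBound (Iio (0 : ℝ) ×ˢ univ) u p G) hI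
  -- a factor `λ ∈ (1, Λ)`
  set lam : ℝ := (1 + Λ) / 2 with hlam
  have h1 : 1 < lam := by rw [hlam]; linarith
  have h2 : lam < Λ := by rw [hlam]; linarith
  exact hfatal lam (2 * α * Real.log lam) h1 h2 u p G hsw hwg le_rfl hdec hsing (hrss lam (one_pos.trans h1))
/-- **T6 — open BOXES of fatal screws around every irrational direction.**  For every `C`, every `I < ⊤` and
every angle `θ₀` with `θ₀/2π ∉ ℚ` there are `c⋆ > 1` and `η > 0` such that no suitable weak solution on the slab with
a weak gradient, `𝐈 ≤ I`, the apex bound of constant `C` and a singular origin is a.e. fixed by a screw `(c, θ)` with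
`1 < c < c⋆`, `|θ − θ₀| < η`: otherwise screws `(c_k, θ_k) → (1, θ₀)` carry such profiles, a subsequence converges in
`L³_loc` (`slabLimit_le`) to a singular apex profile `u`, whose dilation and rotation orbits are continuous in `L³_loc`
(AUX-2, AUX-9), so `u` is a.e. fixed by `R_{θ₀}` (AUX-10), which AUX-1 forbids.  Hence near the identity the
possibly non-fatal screws are confined to cusps at the rational directions `θ ∈ 2πℚ` (whose rays are themselves fatal
for `c^q < c₁`, `rdssApexFatal_rationalAngle_nearOne`). [folklore] -/
theorem rdssApexFatal_nearIrrationalDirection :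
    ∀ (C : ℝ) (I : ENNReal) (θ₀ : ℝ), I < ⊤ → Irrational (θ₀ / (2 * Real.pi)) → ∃ cstar η : ℝ, 1 < cstar ∧ 0 < η ∧ ∀ c θ : ℝ, 1 < c → c < cstar → |θ - θ₀| < η → ∀ (u : ℝ → EuclideanSpace ℝ (Fin 3) → EuclideanSpace ℝ (Fin 3)) (p : ℝ → EuclideanSpace ℝ (Fin 3) → ℝ) (G : ℝ → EuclideanSpace ℝ (Fin 3) → EuclideanSpace ℝ (Fin 3) →L[ℝ] EuclideanSpace ℝ (Fin 3)), Literature.Analysis.FluidPDE.IsSuitableWeakSolutionOn (Literature.Analysis.FluidPDE.slab (EuclideanSpace ℝ (Fin 3)) (Set.Iio 0) isOpen_Iio) 1 0 u p → Literature.Analysis.FluidPDE.HasWeakSpatialGradientOn (Literature.Analysis.FluidPDE.slab (EuclideanSpace ℝ (Fin 3)) (Set.Iio 0) isOpen_Iio) u G → Literature.Analysis.FluidPDE.typeIBound (Set.Iio (0 : ℝ) ×ˢ Set.univ) u p G ≤ I → Literature.Analysis.FluidPDE.HasTypeIDecay C u → Literature.Analysis.FluidPDE.IsBackwardSingularPoint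 u 0 → Function.uncurry (fun t x => Literature.Analysis.FluidPDE.rotZ θ (Literature.Analysis.FluidPDE.nsRescale c u t (Literature.Analysis.FluidPDE.rotZ (-θ) x))) =ᵐ[MeasureTheory.volume.restrict (Set.Iio (0 : ℝ) ×ˢ Set.univ)] Function.uncurry u → False := by
  intro C I θ₀ hI hirr
  rcases lt_or_ge C 0 with hC | hC
  · refine ⟨2, 1, one_lt_two, one_pos, fun c θ _ _ _ u p G _ _ _ hdec _ _ => ?_⟩
    have h := hdec (-1) (by norm_num) 0
    rw [norm_zero, neg_neg, Real.sqrt_one, zero_add, div_one] at h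
    linarith [norm_nonneg (u (-1) 0)]
  by_contra hcon
  push Not at hcon
  have hpos : ∀ k : ℕ, (0 : ℝ) < 1 / ((k : ℝ) + 1) := fun k => by positivity
  choose c θ hc1 hck hθk v q H hsw hwg hIk hdec hsing hinv using
    fun k : ℕ => hcon (1 + 1 / ((k : ℝ) + 1)) (1 / ((k : ℝ) + 1)) (by linarith [hpos k]) (hpos k)
  have hc0 : ∀ k, 0 < c k := fun k => one_pos.trans (hc1 k)
  have h1k : Tendsto (fun k : ℕ => (1 : ℝ) / ((k : ℝ) + 1)) atTop (𝓝 0) := tendsto_one_div_add_atTop_nhds_zero_nat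
  -- `c_k → 1`, `θ_k → θ₀`
  have hc_tend : Tendsto c atTop (𝓝 1) := by
    have h1 : Tendsto (fun k : ℕ => (1 : ℝ) + 1 / ((k : ℝ) + 1)) atTop (𝓝 1) := by
      have h := h1k.const_add (1 : ℝ)
      rwa [add_zero] at h
    exact tendsto_of_tendsto_of_tendsto_of_le_of_le tendsto_const_nhds h1 (fun k => (hc1 k).le)
      (fun k => (hck k).le)
  have hθ_tend : Tendsto θ atTop (𝓝 θ₀) := by
    rw [tendsto_iff_norm_sub_tendsto_zero]
    refine squeeze_zero (fun k => norm_nonneg _) (fun k => ?_) h1k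
    rw [Real.norm_eq_abs]
    exact (hθk k).le
  -- ## compactness
  obtain ⟨u, p, G, φ, hφ, hswu, hwgu, hIu, hdecu, hsingu, hconv⟩ :=
    Summit.NavierStokesRegularity.NavierStokesRegularity.Theorems.SymmetricScarExists.RdssSplit.Robust.slabLimit_le
      C I v q H hC hI (fun k => ⟨hsw k, hwg k, hIk k, hdec k, hsing k⟩)
  have hI4 : 4 * I < ⊤ := ENNReal.mul_lt_top (by simp) hI
  have hIu' : typeIBound (Iio (0 : ℝ) ×ˢ univ) u p G < ⊤ := lt_of_le_of_lt hIu hI4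
  have hmem : ∀ R : ℝ, 0 < R → MemLp (uncurry u) 3
      (volume.restrict (parabolicCylinder R (0 : ℝ × EuclideanSpace ℝ (Fin 3)))) :=
    fun R hR => Summit.NavierStokesRegularity.NavierStokesRegularity.Theorems.memLp_three_of_slabProfile hwgu hIu' hR
  have hcφ0 : ∀ j : ℕ, 0 < c (φ j) := fun j => hc0 (φ j)
  have hcφ : Tendsto (fun j => c (φ j)) atTop (𝓝 1) := hc_tend.comp hφ.tendsto_atTop
  have hθφ : Tendsto (fun j => θ (φ j)) atTop (𝓝 θ₀) := hθ_tend.comp hφ.tendsto_atTop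
  -- ## AUX-2 / AUX-9: the dilation and rotation orbits of the limit are continuous
  have hdil := stub_dilationContinuity u hmem (fun j => c (φ j)) hcφ0 hcφ
  have hrot := stub_rotationOrbitContinuity u hmem (fun j => θ (φ j)) θ₀ hθφ
  -- ## AUX-10: the limit is a.e. fixed by `R_{θ₀}`
  have hVm : ∀ (j : ℕ) (r : ℝ), 0 < r → ∀ R : ℝ, 0 < R →
      AEStronglyMeasurable (uncurry (nsRescale r (v (φ j))))
        (volume.restrict (parabolicCylinder R (0 : ℝ × EuclideanSpace ℝ (Fin 3)))) :=
    fun j => aestronglyMeasurable_nsRescale_slabProfile (hsw (φ j)) (hwg (φ j))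
  have hum := aestronglyMeasurable_nsRescale_slabProfile hswu hwgu
  have hfix := stub_screwInvariantLimitMoving (fun j => θ (φ j)) θ₀ (fun j => c (φ j)) (fun j => v (φ j)) u hcφ0 hcφ
    hθφ hVm hum hconv hdil hrot (fun j => (hinv (φ j)).1)
  -- ## AUX-1
  exact stub_irrationalRotationApexFatal u p G C θ₀ hswu hwgu hIu' hdecu hsingu hirr hfix


end Summit.NavierStokesRegularity.NavierStokesRegularity.Theorems.SymmetricScarExists.RdssSplit.NearIdentity

end
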